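import Summits.ValiantsHypothesis.ValiantsHypothesis.Theorems.LacunarySymmetroidMatrixDescartesCensusDoorA34FlagDescentDeep

/-!
# `MatrixDescartes` census — DOOR A at `(3,4)`: the sub-sub-stratum lift at the TOP end, and its door / stub readings

HONEST FRAMING.  Object-search cell `pub-symmetroid`, engine seat `val-sym-eng-2` (g2); helper file beside the registered strata line
`Cruxes/DoorA34/Lines/strata.lean` on stmt-ValiantsHypothesis-19980 (`DoorA34 = PosRootLawAt 3 4 18`: OPEN, typed, never asserted here).
MODULE NOTE (desk R2448 (B), OPS15): re-cut of the unfiled reader `…SubStratumLiftDeepTop` onto the built chain — imports `…FlagDescentDeep`.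
Companion of `…CensusDoorA34FlagDescentDeep` (bottom end).  By letter reversal `t ↦ 1/t`, on the sheet of the exact object
`Census.SubSubStratumFifteen01458` (p596640) — `det S₃ = 0`, `tr(adj S₃·S₂) = 0`, `tr(adj S₃·S₁) = 0` on a sorted support in the
chamber `2 d₂ < d₁ + d₃` — with `kᵀ adj(S₃) k ≠ 0`:

* `card_posRoots_of_nullTop_subSubStratum_two` — an alternation chain of `N + 1` positive points gives, after `S₁ ↦ S₁ + η₁·kkᵀ` and
  `S₂ ↦ S₂ + η₂·kkᵀ` (same support, `S₃` untouched: still the null-top stratum), at least `N + 2` distinct positive roots;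
* `card_posRoots_of_nullTop_subSubStratum` — unfolding `S₃` as well: at least `N + 3`;
* `no_nullTop_subSubStratum_sixteen_of_posRootLawOn` — DOOR READING (`N = 16`): a kernel row `PosRootLawOn 3 4 18 d` excludes
  chain-SIXTEENS two sheets down (they would lift to nineteens) — the door forces `≤ 15` there, the count ATTAINED by p596640;
* `no_nullTop_subSubStratum_sixteen_of_nullTopCeiling` — STUB READING: `stub_nullTopCeiling` taken VERBATIM as a hypothesis forces
  the same (two unfoldings give a null-top eighteen).

NOTHING here bounds `ζ_sym(3,4)` (registers `18 ≤ ζ_sym(3,4) ≤ 19` unchanged); `DoorA34` and both stubs stay OPEN; nothing bears on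
`MatrixDescartes` (stmt-ValiantsHypothesis-18050) or `VP ≠ VNP` — VP≠VNP not moved.

[folklore] Alternation chains; letter reversal `t ↦ 1/t`.
-/

-- `Summit.ValiantsHypothesis.ValiantsHypothesis.…` repeats a component by the D-0017 layout
-- (single-conjunct summit), which the `dupNamespace` linter flags; the name is mandated.
set_option linter.dupNamespace false

namespace Summit.ValiantsHypothesis.ValiantsHypothesis.Theorems.LacunarySymmetroidMatrixDescartes.Census

open Polynomial Finset
open scoped BigOperators Polynomial Matrix
open Summit.ValiantsHypothesis.ValiantsHypothesis.Theorems.MatrixDescartes.Negative (PosRootLawAt)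

/-- exponent bookkeeping for the mirror of a sorted support in the chamber `2 d₂ < d₁ + d₃`. [folklore] -/
theorem mirror_hyps_of_strictMono {d : Fin 4 → ℕ} (hd : StrictMono d) (hch : 2 * d 2 < d 1 + d 3) :
    (fun l => d 3 - d (Fin.rev l)) 0 < (fun l => d 3 - d (Fin.rev l)) 1 ∧
    (∀ l : Fin 4, l ≠ 0 → l ≠ 1 → (fun l => d 3 - d (Fin.rev l)) 1 < (fun l => d 3 - d (Fin.rev l)) l) ∧
    (fun l => d 3 - d (Fin.rev l)) 2 < (fun l => d 3 - d (Fin.rev l)) 3 ∧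
    (fun l => d 3 - d (Fin.rev l)) 0 + (fun l => d 3 - d (Fin.rev l)) 2 < 2 * (fun l => d 3 - d (Fin.rev l)) 1 := by
  have h01 : d 0 < d 1 := hd (by decide)
  have h12 : d 1 < d 2 := hd (by decide)
  have h23 : d 2 < d 3 := hd (by decide)
  have r0 : Fin.rev (0 : Fin 4) = 3 := by decide
  have r1 : Fin.rev (1 : Fin 4) = 2 := by decide
  have r2 : Fin.rev (2 : Fin 4) = 1 := by decide
  have r3 : Fin.rev (3 : Fin 4) = 0 := by decide
  refine ⟨?_, ?_, ?_, ?_⟩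
  · simp only [r0, r1]; omega
  · intro l hl hl1
    fin_cases l
    · exact absurd rfl hl
    · exact absurd rfl hl1
    · show d 3 - d (Fin.rev 1) < d 3 - d (Fin.rev 2)
      rw [r1, r2]; omega
    · show d 3 - d (Fin.rev 1) < d 3 - d (Fin.rev 3)
      rw [r1, r3]; omega
  · simp only [r2, r3]; omega
  · simp only [r0, r1, r2]; omega

/-- **SUB-SUB-STRATUM LIFT (top end, two steps, count currency).**  Sorted support in the chamber `2 d₂ < d₁ + d₃`, `det S₃ = 0`,
`tr(adj S₃·S₂) = 0`, `tr(adj S₃·S₁) = 0`, `kᵀ adj(S₃) k ≠ 0`, an alternation chain of `N + 1` positive points ⇒ for some reals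
`η₁, η₂` the pencil with `S₁ ↦ S₁ + η₁·kkᵀ`, `S₂ ↦ S₂ + η₂·kkᵀ` (still `det S₃ = 0`) has `≥ N + 2` distinct positive roots.  With
`N = 16`: a sub-sub-stratum chain-SIXTEEN lifts to a null-top EIGHTEEN. [folklore] -/
theorem card_posRoots_of_nullTop_subSubStratum_two (d : Fin 4 → ℕ) (hd : StrictMono d) (hch : 2 * d 2 < d 1 + d 3)
    (S : Fin 4 → Matrix (Fin 3) (Fin 3) ℝ) (hdet : (S 3).det = 0) (htr2 : ((S 3).adjugate * S 2).trace = 0)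
    (htr1 : ((S 3).adjugate * S 1).trace = 0)
    (k : Fin 3 → ℝ) (hk : k ⬝ᵥ ((S 3).adjugate *ᵥ k) ≠ 0)
    {N : ℕ} {s : ℝ} {a : Fin (N + 1) → ℝ}
    (hchain : AltChain ((∑ l, (X : ℝ[X]) ^ d l • (S l).map C).det) N s a) :
    ∃ η₁ η₂ : ℝ, N + 2 ≤ ((((∑ l, (X : ℝ[X]) ^ d l •
      (((S l + if l = 1 then η₁ • Matrix.vecMulVec k k else 0) + if l = 2 then η₂ • Matrix.vecMulVec k k else 0)).map C)).det
        ).roots.toFinset.filter (fun t => 0 < t)).card := by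
  classical
  have hdN : ∀ l, d l ≤ d 3 := fun l => hd.monotone (Fin.le_last l)
  set d' : Fin 4 → ℕ := fun l => d 3 - d (Fin.rev l) with hd'
  set S' : Fin 4 → Matrix (Fin 3) (Fin 3) ℝ := fun l => S (Fin.rev l) with hS'
  obtain ⟨h01', h1', h23', hch'⟩ := mirror_hyps_of_strictMono hd hch
  have hrev0 : Fin.rev (0 : Fin 4) = 3 := by decide
  have hrev1 : Fin.rev (1 : Fin 4) = 2 := by decide
  have hrev2 : Fin.rev (2 : Fin 4) = 1 := by decide
  have hdet' : (S' 0).det = 0 := by simp only [hS', hrev0]; exact hdet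
  have htr1' : ((S' 0).adjugate * S' 1).trace = 0 := by simp only [hS', hrev0, hrev1]; exact htr2
  have htr2' : ((S' 0).adjugate * S' 2).trace = 0 := by simp only [hS', hrev0, hrev2]; exact htr1
  have hk' : k ⬝ᵥ ((S' 0).adjugate *ᵥ k) ≠ 0 := by simp only [hS', hrev0]; exact hk
  have hmir := altChain_mirror d (d 3) hdN S hchain
  have hpencil : (∑ l, (X : ℝ[X]) ^ d' l • (S' l).map C) = ∑ l, (X : ℝ[X]) ^ (d 3 - d l) • (S l).map C := by
    simp only [hd', hS']
    exact pencil_comp_equiv Fin.revPerm (fun l => d 3 - d l) S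
  have hchain' : AltChain ((∑ l, (X : ℝ[X]) ^ d' l • (S' l).map C).det) N
      ((((∑ l, (X : ℝ[X]) ^ d l • (S l).map C).det).eval (a (Fin.last N)))) (fun i => (a (Fin.rev i))⁻¹) := by
    rw [hpencil]; exact hmir
  -- the bottom lemma perturbs `S' 2 = S 1` (by `ηa`) and then `S' 1 = S 2` (by `ηb`)
  obtain ⟨ηa, ηb, s', a', hη⟩ :=
    exists_altChain_two_of_nullBottom_subSubStratum d' h01' h1' h23' hch' S' hdet' htr1' htr2' k hk' hchain'
  refine ⟨ηa, ηb, ?_⟩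
  set T : Fin 4 → Matrix (Fin 3) (Fin 3) ℝ :=
    fun l => (S l + if l = 1 then ηa • Matrix.vecMulVec k k else 0) + if l = 2 then ηb • Matrix.vecMulVec k k else 0 with hT
  have hT' : (fun l => (S' l + if l = 2 then ηa • Matrix.vecMulVec k k else 0) + if l = 1 then ηb • Matrix.vecMulVec k k else 0)
      = fun l => T (Fin.rev l) := by
    funext l
    simp only [hS', hT]
    have e2 : (l = 2) ↔ (Fin.rev l = 1) := by
      constructor
      · intro h; rw [h]; decide
      · intro h; have := congrArg Fin.rev h; simpa using this
    have e1 : (l = 1) ↔ (Fin.rev l = 2) := by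
      constructor
      · intro h; rw [h]; decide
      · intro h; have := congrArg Fin.rev h; simpa using this
    by_cases hl2 : l = 2
    · have hl1 : l ≠ 1 := by rw [hl2]; decide
      rw [if_pos hl2, if_neg hl1, if_pos (e2.mp hl2), if_neg (fun h => hl1 (e1.mpr h))]
    · rw [if_neg hl2, if_neg (fun h => hl2 (e2.mpr h))]
      by_cases hl1 : l = 1
      · rw [if_pos hl1, if_pos (e1.mp hl1)]
      · rw [if_neg hl1, if_neg (fun h => hl1 (e1.mpr h))]
  have hpencilT : (∑ l, (X : ℝ[X]) ^ d' l •
      ((fun l => (S' l + if l = 2 then ηa • Matrix.vecMulVec k k else 0) + if l = 1 then ηb • Matrix.vecMulVec k k else 0) l).map C)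
      = ∑ l, (X : ℝ[X]) ^ (d 3 - d l) • (T l).map C := by
    rw [hT']
    simp only [hd']
    exact pencil_comp_equiv Fin.revPerm (fun l => d 3 - d l) T
  have hcount := le_card_posRoots_of_altChain hη
  rw [hpencilT, card_posRoots_det_pencil_mirror d (d 3) hdN T] at hcount
  exact hcount

/-- **SUB-SUB-STRATUM LIFT (top end, three steps, count currency).**  Under the same hypotheses, unfolding `S₁`, `S₂` and then `S₃`
gives at least `N + 3` distinct positive roots.  With `N = 16`: a sub-sub-stratum chain-SIXTEEN lifts to a NINETEEN. [folklore] -/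
theorem card_posRoots_of_nullTop_subSubStratum (d : Fin 4 → ℕ) (hd : StrictMono d) (hch : 2 * d 2 < d 1 + d 3)
    (S : Fin 4 → Matrix (Fin 3) (Fin 3) ℝ) (hdet : (S 3).det = 0) (htr2 : ((S 3).adjugate * S 2).trace = 0)
    (htr1 : ((S 3).adjugate * S 1).trace = 0)
    (k : Fin 3 → ℝ) (hk : k ⬝ᵥ ((S 3).adjugate *ᵥ k) ≠ 0)
    {N : ℕ} {s : ℝ} {a : Fin (N + 1) → ℝ}
    (hchain : AltChain ((∑ l, (X : ℝ[X]) ^ d l • (S l).map C).det) N s a) :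
    ∃ η₁ η₂ η₃ : ℝ, N + 3 ≤ ((((∑ l, (X : ℝ[X]) ^ d l •
      ((((S l + if l = 1 then η₁ • Matrix.vecMulVec k k else 0) + if l = 2 then η₂ • Matrix.vecMulVec k k else 0)
        + if l = 3 then η₃ • Matrix.vecMulVec k k else 0)).map C)).det).roots.toFinset.filter (fun t => 0 < t)).card := by
  classical
  have hdN : ∀ l, d l ≤ d 3 := fun l => hd.monotone (Fin.le_last l)
  set d' : Fin 4 → ℕ := fun l => d 3 - d (Fin.rev l) with hd'
  set S' : Fin 4 → Matrix (Fin 3) (Fin 3) ℝ := fun l => S (Fin.rev l) with hS'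
  obtain ⟨h01', h1', h23', hch'⟩ := mirror_hyps_of_strictMono hd hch
  have hrev0 : Fin.rev (0 : Fin 4) = 3 := by decide
  have hrev1 : Fin.rev (1 : Fin 4) = 2 := by decide
  have hrev2 : Fin.rev (2 : Fin 4) = 1 := by decide
  have hdet' : (S' 0).det = 0 := by simp only [hS', hrev0]; exact hdet
  have htr1' : ((S' 0).adjugate * S' 1).trace = 0 := by simp only [hS', hrev0, hrev1]; exact htr2
  have htr2' : ((S' 0).adjugate * S' 2).trace = 0 := by simp only [hS', hrev0, hrev2]; exact htr1
  have hk' : k ⬝ᵥ ((S' 0).adjugate *ᵥ k) ≠ 0 := by simp only [hS', hrev0]; exact hk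
  have hmir := altChain_mirror d (d 3) hdN S hchain
  have hpencil : (∑ l, (X : ℝ[X]) ^ d' l • (S' l).map C) = ∑ l, (X : ℝ[X]) ^ (d 3 - d l) • (S l).map C := by
    simp only [hd', hS']
    exact pencil_comp_equiv Fin.revPerm (fun l => d 3 - d l) S
  have hchain' : AltChain ((∑ l, (X : ℝ[X]) ^ d' l • (S' l).map C).det) N
      ((((∑ l, (X : ℝ[X]) ^ d l • (S l).map C).det).eval (a (Fin.last N)))) (fun i => (a (Fin.rev i))⁻¹) := by
    rw [hpencil]; exact hmir
  -- the bottom lemma perturbs `S' 2 = S 1` (`ηa`), `S' 1 = S 2` (`ηb`), `S' 0 = S 3` (`ηc`)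
  obtain ⟨ηa, ηb, ηc, hη⟩ :=
    card_posRoots_of_nullBottom_subSubStratum d' h01' h1' h23' hch' S' hdet' htr1' htr2' k hk' hchain'
  refine ⟨ηa, ηb, ηc, ?_⟩
  set T : Fin 4 → Matrix (Fin 3) (Fin 3) ℝ :=
    fun l => ((S l + if l = 1 then ηa • Matrix.vecMulVec k k else 0) + if l = 2 then ηb • Matrix.vecMulVec k k else 0)
      + if l = 3 then ηc • Matrix.vecMulVec k k else 0 with hT
  have hT' : (fun l => ((S' l + if l = 2 then ηa • Matrix.vecMulVec k k else 0) + if l = 1 then ηb • Matrix.vecMulVec k k else 0)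
      + if l = 0 then ηc • Matrix.vecMulVec k k else 0) = fun l => T (Fin.rev l) := by
    funext l
    simp only [hS', hT]
    have e2 : (l = 2) ↔ (Fin.rev l = 1) := by
      constructor
      · intro h; rw [h]; decide
      · intro h; have := congrArg Fin.rev h; simpa using this
    have e1 : (l = 1) ↔ (Fin.rev l = 2) := by
      constructor
      · intro h; rw [h]; decide
      · intro h; have := congrArg Fin.rev h; simpa using this
    have e0 : (l = 0) ↔ (Fin.rev l = 3) := by
      constructor
      · intro h; rw [h]; decide
      · intro h; have := congrArg Fin.rev h; simpa using this
    by_cases hl2 : l = 2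
    · have hl1 : l ≠ 1 := by rw [hl2]; decide
      have hl0 : l ≠ 0 := by rw [hl2]; decide
      rw [if_pos hl2, if_neg hl1, if_neg hl0, if_pos (e2.mp hl2), if_neg (fun h => hl1 (e1.mpr h)),
        if_neg (fun h => hl0 (e0.mpr h))]
    · rw [if_neg hl2, if_neg (fun h => hl2 (e2.mpr h))]
      by_cases hl1 : l = 1
      · have hl0 : l ≠ 0 := by rw [hl1]; decide
        rw [if_pos hl1, if_neg hl0, if_pos (e1.mp hl1), if_neg (fun h => hl0 (e0.mpr h))]
      · rw [if_neg hl1, if_neg (fun h => hl1 (e1.mpr h))]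
        by_cases hl0 : l = 0
        · rw [if_pos hl0, if_pos (e0.mp hl0)]
        · rw [if_neg hl0, if_neg (fun h => hl0 (e0.mpr h))]
  have hpencilT : (∑ l, (X : ℝ[X]) ^ d' l •
      ((fun l => ((S' l + if l = 2 then ηa • Matrix.vecMulVec k k else 0) + if l = 1 then ηb • Matrix.vecMulVec k k else 0)
        + if l = 0 then ηc • Matrix.vecMulVec k k else 0) l).map C)
      = ∑ l, (X : ℝ[X]) ^ (d 3 - d l) • (T l).map C := by
    rw [hT']
    simp only [hd']
    exact pencil_comp_equiv Fin.revPerm (fun l => d 3 - d l) T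
  rw [hpencilT, card_posRoots_det_pencil_mirror d (d 3) hdN T] at hη
  exact hη

/-! ## Door and stub readings two sheets down -/

/-- **DOOR-A READING (sub-sub-stratum chain-sixteens).**  On a sorted support in the chamber `2 d₂ < d₁ + d₃` where the row
`PosRootLawOn 3 4 18 d` holds, NO real symmetric `(3,4)` pencil with `det S₃ = 0`, `tr(adj S₃·S₂) = 0`, `tr(adj S₃·S₁) = 0`
(`kᵀ adj(S₃) k ≠ 0`) carries an alternation chain of `17` positive points: it would lift to a nineteen on `d`.  The door thus forces
`≤ 15` (chain currency) two sheets down — the count attained by `Census.SubSubStratumFifteen01458`. [folklore] -/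
theorem no_nullTop_subSubStratum_sixteen_of_posRootLawOn {d : Fin 4 → ℕ} (hrow : PosRootLawOn 3 4 18 d)
    (hd : StrictMono d) (hch : 2 * d 2 < d 1 + d 3)
    (S : Fin 4 → Matrix (Fin 3) (Fin 3) ℝ) (hS : ∀ l, (S l).IsSymm) (hdet : (S 3).det = 0)
    (htr2 : ((S 3).adjugate * S 2).trace = 0) (htr1 : ((S 3).adjugate * S 1).trace = 0)
    (k : Fin 3 → ℝ) (hk : k ⬝ᵥ ((S 3).adjugate *ᵥ k) ≠ 0) (s : ℝ) (a : Fin 17 → ℝ) :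
    ¬ AltChain ((∑ l, (X : ℝ[X]) ^ d l • (S l).map C).det) 16 s a := by
  intro hchain
  obtain ⟨η₁, η₂, η₃, h19⟩ := card_posRoots_of_nullTop_subSubStratum d hd hch S hdet htr2 htr1 k hk hchain
  have hsymm : ∀ l, ((((S l + if l = 1 then η₁ • Matrix.vecMulVec k k else 0)
      + if l = 2 then η₂ • Matrix.vecMulVec k k else 0)) + if l = 3 then η₃ • Matrix.vecMulVec k k else 0).IsSymm := fun l =>
    rankOne_update_letter_isSymm 3 _
      (rankOne_update_letter_isSymm 2 _ (rankOne_update_letter_isSymm 1 S hS k η₁) k η₂) k η₃ l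
  have := hrow _ hsymm
  omega

/-- **STUB READING (`stub_nullTopCeiling` ⇒ deficiency one two sheets down).**  If the strata line's second stub holds (verbatim,
as a hypothesis), then on every sorted support in the chamber `2 d₂ < d₁ + d₃` NO real symmetric pencil with `det S₃ = 0`,
`tr(adj S₃·S₂) = tr(adj S₃·S₁) = 0` (`kᵀ adj(S₃) k ≠ 0`) carries an alternation chain of `17` positive points (two unfoldings would
give a null-top eighteen). [folklore] -/
theorem no_nullTop_subSubStratum_sixteen_of_nullTopCeiling
    (hstub : ∀ (d : Fin 4 → ℕ) (S : Fin 4 → Matrix (Fin 3) (Fin 3) ℝ), (∀ l, (S l).IsSymm) → StrictMono d →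
      (S 3).det = 0 → ((∑ l, (Polynomial.X : Polynomial ℝ) ^ d l • (S l).map Polynomial.C).det.roots.toFinset.filter
        (fun t => 0 < t)).card ≤ 17)
    (d : Fin 4 → ℕ) (hd : StrictMono d) (hch : 2 * d 2 < d 1 + d 3)
    (S : Fin 4 → Matrix (Fin 3) (Fin 3) ℝ) (hS : ∀ l, (S l).IsSymm) (hdet : (S 3).det = 0)
    (htr2 : ((S 3).adjugate * S 2).trace = 0) (htr1 : ((S 3).adjugate * S 1).trace = 0)
    (k : Fin 3 → ℝ) (hk : k ⬝ᵥ ((S 3).adjugate *ᵥ k) ≠ 0) (s : ℝ) (a : Fin 17 → ℝ) :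
    ¬ AltChain ((∑ l, (X : ℝ[X]) ^ d l • (S l).map C).det) 16 s a := by
  intro hchain
  obtain ⟨η₁, η₂, h18⟩ := card_posRoots_of_nullTop_subSubStratum_two d hd hch S hdet htr2 htr1 k hk hchain
  have hT3 : ((fun l : Fin 4 => (S l + if l = 1 then η₁ • Matrix.vecMulVec k k else 0)
      + if l = 2 then η₂ • Matrix.vecMulVec k k else 0) 3).det = 0 := by
    simp only [show ((3 : Fin 4) = 1) ↔ False from by decide, show ((3 : Fin 4) = 2) ↔ False from by decide, if_false,
      add_zero]
    exact hdet
  have := hstub d (fun l => (S l + if l = 1 then η₁ • Matrix.vecMulVec k k else 0)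
      + if l = 2 then η₂ • Matrix.vecMulVec k k else 0)
    (rankOne_update_letter_isSymm 2 _ (rankOne_update_letter_isSymm 1 S hS k η₁) k η₂) hd hT3
  omega

end Summit.ValiantsHypothesis.ValiantsHypothesis.Theorems.LacunarySymmetroidMatrixDescartes.Census
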